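import Summits.AtomisticToContinuum.Crystallization.Theorems.OverbindingBudgetAffineRunCutSheetCover
import Summits.AtomisticToContinuum.Crystallization.Theorems.OverbindingBudgetAffineRunCutCrossCore

/-!
# `OverbindingBudget` / crux `RobustDefectLimitWindows` (stmt-AtomisticToContinuum-31280) — «RunCut» part 22A «SHEETHOP»:
# ONE HOP OF THE COVERING WALK (the chain is CONSTRUCTED here)

Support file (lens-4 g89; order of record (2c) = the POINTWISE crossing-exclusion engine at `ρ₁ = 30`, critic rows 1587 (A)(R), 1590 (A),
1596 (A), 1600 (B); memos `g88/memo/SHEETWALK-g88.md` §4, `g89/memo/SHEETCOVER-g89.md` §1).  Parts 16–21 proved everything POINTWISE about basal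
steps, chains and the greedy primitive; this file turns them into an EXISTENCE statement: inside the charted ball of a pivot `j` (ONE chart datum
`(Ac, Qc, Pc, fc)` on `B(y j, ρ₁ ν_j)`, the shape of `…RunCutRebase.charts_of_affDeepReg_radius`), an hcp-charted basal chain `c 0, …, c L`,
a MODE `(k, τ) ∈ {(7, 5.24), (4, 2.87), (3, 2.12)}` (the rungs of `…SheetCover.descent_envelope`) with `L + k ≤ 60`, and a target point `T` at
lateral distance `≤ τ ν_0` from `y (c L)` (lateral = orthogonal to the chain's first unit axis `n = N_{c 0}`), at height `≤ η ν_0` over the plane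
of `c 0`, with the region inequality `dist T (y j) + (E + 1.03) ν_0 ≤ ρ₁ ν_j` (`E² ≥ τ² + (η + 0.61)²`), the chain EXTENDS by `s ≤ k` greedy
basal steps — every new site again in the ball and again an h-site — to a site at lateral distance `≤ (16/25) ν_0` from `T`.

Mechanism.  The greedy successor map is obtained by `Classical.choice` from `…SheetCover.greedy_step` (one `choose` over all sites, guarded by
«in the ball ∧ h-site ∧ axis within `1/50` of `±n`»); the extension is `c' (L + s) = nxt^[s] (c L)`.  By induction on `s` WHILE THE HOP RUNS
(`16/25 < R` at all earlier times of the hop): the prefix is a chain in the sense of `…SheetWalk` (`sheet_walk_axis_unit` gives the axis guard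
`2.6·10⁻⁴·59 + 0 ≤ 1/50`, `sheet_walk_record` (i) the scale window, `sheet_walk_height` the height `≤ 0.61 ν_0`), the greedy step fires
(`greedy_step` (i)(ii)(iii)), the normalised law holds (`descent_law_normalise`), the lateral distance does not increase, the new site is within
`E ν_0 + 1.03 ν_0` of `T` hence in the ball (`…SheetCross.dist_sq_le_of_height_of_lateral`), and it is an h-site (`…SheetLetter.basal_step_record`
(A)).  Then `descent_envelope` (localised form) stops the hop within `7` steps and `Nat.find` picks the first stop.

* §1 `site_charts`, `chain_charts` — the hcp clause families at an h-site / along an h-chain, read off the chart datum;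
* §2 `sheet_hop_guard` (axis guard, scale window, height along the running chain), `sheet_hop_advance` (law + ball + h-site after one greedy step),
  ★★ `sheet_hop` — the statement above (0 definitions; the chain and the successor map are proof-internal terms).
[this file: 0 definitions, 5 theorems; imports the tree files `…RunCutSheetCover` (part 21) and `…RunCutCrossCore` (part 19) only; standard axioms]
-/

namespace Summit.AtomisticToContinuum.Crystallization.Theorems.OverbindingBudgetAffineRunCutSheetHop

open scoped InnerProductSpace
open Literature.Geometry.DiscreteGeometry
open Summit.AtomisticToContinuum.Crystallization.Theorems.OverbindingBudgetAffineRunCutSheetLetter (basal_step_record)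
open Summit.AtomisticToContinuum.Crystallization.Theorems.OverbindingBudgetAffineRunCutSheetWalkA (frame_axis_norm frame_axis_close)
open Summit.AtomisticToContinuum.Crystallization.Theorems.OverbindingBudgetAffineRunCutSheetWalk
  (sheet_walk_record sheet_walk_height sheet_walk_axis_unit)
open Summit.AtomisticToContinuum.Crystallization.Theorems.OverbindingBudgetAffineRunCutSheetCover
  (greedy_step descent_law_normalise descent_envelope)
open Summit.AtomisticToContinuum.Crystallization.Theorems.OverbindingBudgetAffineRunCutSheetCross (dist_sq_le_of_height_of_lateral)
open Summit.AtomisticToContinuum.Crystallization.Theorems.OverbindingBudgetAffineCompressedCutEstablish (nearestDist_pos_of_frame)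

variable {N : ℕ}

local notation "E3" => EuclideanSpace ℝ (Fin 3)

section Atlas

/-! ONE chart datum on the ball `B(y j, ρ₁ ν_j)`: patterns `Pc i ∈ {fcc, hcp}`, frames `Ac i` within `10⁻³` of isometries `Qc i`, registrations `fc i`
at `10⁻⁴ ν_i`, injective and exhaustive on the `(3/2 + 1/450) ν_i`-ball (VERBATIM the five ball clauses of `…RunCutRebase.charts_of_affDeepReg_radius`). -/
variable {y : Fin N → E3} (hy : Function.Injective y) {j : Fin N} {ρ₁ : ℝ}
  {Ac : Fin N → (E3 →ₗ[ℝ] E3)} {Qc : Fin N → (E3 →ₗᵢ[ℝ] E3)} {Pc : Fin N → Finset E3} {fc : Fin N → E3 → E3}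
  (hP : ∀ i, dist (y i) (y j) ≤ ρ₁ * nearestDist y j → Pc i = fccTwoShellPattern ∨ Pc i = hcpTwoShellPattern)
  (hA : ∀ i, dist (y i) (y j) ≤ ρ₁ * nearestDist y j → ∀ v ∈ Pc i, ‖Ac i v - Qc i v‖ ≤ 1 / 1000)
  (hf : ∀ i, dist (y i) (y j) ≤ ρ₁ * nearestDist y j → ∀ v ∈ Pc i,
    fc i v ∈ Set.range y ∧ dist (fc i v) (y i + nearestDist y i • Ac i v) ≤ 1 / 10 ^ 4 * nearestDist y i)
  (hinj : ∀ i, dist (y i) (y j) ≤ ρ₁ * nearestDist y j → Set.InjOn (fc i) ↑(Pc i))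
  (hex : ∀ i, dist (y i) (y j) ≤ ρ₁ * nearestDist y j → ∀ k : Fin N, k ≠ i →
    dist (y k) (y i) ≤ (3 / 2 + 1 / 450) * nearestDist y i → ∃ v ∈ Pc i, fc i v = y k)

/-! ## §1 Reading the hcp clause families off the chart datum -/

section Reading

include hA hf hinj hex

/-- At an h-site of the ball (`Pc i = hcp`) the chart datum supplies the four hcp clause families of parts 16/20/21. [this file · kind: glue] -/
theorem site_charts {i : Fin N} (hball : dist (y i) (y j) ≤ ρ₁ * nearestDist y j) (hPi : Pc i = hcpTwoShellPattern) :
    (∀ v ∈ hcpTwoShellPattern, ‖Ac i v - Qc i v‖ ≤ 1 / 1000) ∧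
    (∀ v ∈ hcpTwoShellPattern, fc i v ∈ Set.range y ∧ dist (fc i v) (y i + nearestDist y i • Ac i v) ≤ 1 / 10 ^ 4 * nearestDist y i) ∧
    Set.InjOn (fc i) ↑hcpTwoShellPattern ∧
    (∀ k : Fin N, k ≠ i → dist (y k) (y i) ≤ (3 / 2 + 1 / 450) * nearestDist y i → ∃ v ∈ hcpTwoShellPattern, fc i v = y k) := by
  have hA' := hA i hball
  have hf' := hf i hball
  have hinj' := hinj i hball
  have hex' := hex i hball
  rw [hPi] at hA' hf' hinj' hex'
  exact ⟨hA', hf', hinj', hex'⟩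

/-- Along an h-chain of the ball the chart datum supplies the chain clause families of `…SheetWalk` (charts indexed by time). [this file · kind: glue] -/
theorem chain_charts {c : ℕ → Fin N} {L : ℕ}
    (hpre : ∀ t, t ≤ L → dist (y (c t)) (y j) ≤ ρ₁ * nearestDist y j ∧ Pc (c t) = hcpTwoShellPattern) :
    (∀ t, t ≤ L → ∀ v ∈ hcpTwoShellPattern, ‖Ac (c t) v - Qc (c t) v‖ ≤ 1 / 1000) ∧
    (∀ t, t ≤ L → ∀ v ∈ hcpTwoShellPattern,
      fc (c t) v ∈ Set.range y ∧ dist (fc (c t) v) (y (c t) + nearestDist y (c t) • Ac (c t) v) ≤ 1 / 10 ^ 4 * nearestDist y (c t)) ∧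
    (∀ t, t ≤ L → Set.InjOn (fc (c t)) ↑hcpTwoShellPattern) ∧
    (∀ t, t ≤ L → ∀ k : Fin N, k ≠ c t → dist (y k) (y (c t)) ≤ (3 / 2 + 1 / 450) * nearestDist y (c t) →
      ∃ v ∈ hcpTwoShellPattern, fc (c t) v = y k) :=
  ⟨fun t ht => (site_charts hA hf hinj hex (hpre t ht).1 (hpre t ht).2).1,
    fun t ht => (site_charts hA hf hinj hex (hpre t ht).1 (hpre t ht).2).2.1,
    fun t ht => (site_charts hA hf hinj hex (hpre t ht).1 (hpre t ht).2).2.2.1,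
    fun t ht => (site_charts hA hf hinj hex (hpre t ht).1 (hpre t ht).2).2.2.2⟩

end Reading

/-! ## §2 The hop -/

include hy hA hf hinj hex

/-- Along an h-chain `c 0 … c t` of the ball (`t ≤ 59`, basal steps `u`): the GUARD of the greedy step at time `t` — the unit axis of the chart at
`c t` is within `1/50` of `±n` (`n` = unit axis at `c 0`; `…SheetWalk.sheet_walk_axis_unit`: `2.6·10⁻⁴·59 ≤ 1/50`) — together with the scale
window `|ν_t − ν_0| ≤ (0.0026 + 3·10⁻⁴ t) ν_0` (so `ν_t ≤ 1.0203 ν_0`) and the height `|⟪n, y (c t) − y (c 0)⟫| ≤ 0.61 ν_0`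
(`sheet_walk_record` (i), `sheet_walk_height`: `13·10⁻⁵·59² + 25·10⁻⁴·59 = 0.60003`). [this file · kind: proof] -/
theorem sheet_hop_guard {c : ℕ → Fin N} {u : ℕ → E3} {t : ℕ} (ht : t ≤ 59)
    (hAll : ∀ t', t' ≤ t → dist (y (c t')) (y j) ≤ ρ₁ * nearestDist y j ∧ Pc (c t') = hcpTwoShellPattern)
    (hBll : ∀ t', t' < t → u t' ∈ hcpTwoShellPattern ∧ u t' 0 + u t' 1 + u t' 2 = 0 ∧ fc (c t') (u t') = y (c (t' + 1)))
    {n : E3} (hn : n = (‖Ac (c 0) ((Real.sqrt 18)⁻¹ • intVec ![4, 4, 4])‖⁻¹ • Ac (c 0) ((Real.sqrt 18)⁻¹ • intVec ![4, 4, 4]) : E3)) :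
    (∃ σ : ℝ, (σ = 1 ∨ σ = -1) ∧
      ‖(‖Ac (c t) ((Real.sqrt 18)⁻¹ • intVec ![4, 4, 4])‖⁻¹ • Ac (c t) ((Real.sqrt 18)⁻¹ • intVec ![4, 4, 4]) : E3) - σ • n‖ ≤ 1 / 50) ∧
    |nearestDist y (c t) - nearestDist y (c 0)| ≤ (26 / 10000 + 3 / 10000 * t) * nearestDist y (c 0) ∧
    nearestDist y (c t) ≤ 10203 / 10000 * nearestDist y (c 0) ∧
    |⟪n, y (c t) - y (c 0)⟫_ℝ| ≤ 61 / 100 * nearestDist y (c 0) := by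
  obtain ⟨hA1, hf1, hinj1, hex1⟩ := chain_charts hA hf hinj hex hAll
  have hν₀ : 0 < nearestDist y (c 0) :=
    nearestDist_pos_of_frame hy (Or.inr rfl) (fun v hv => (hf1 0 (Nat.zero_le _) v hv).1) (hinj1 0 (Nat.zero_le _))
  have ht' : (t : ℝ) ≤ 59 := by exact_mod_cast ht
  have ht0 : (0 : ℝ) ≤ t := Nat.cast_nonneg t
  obtain ⟨σ, hσ, hax⟩ := sheet_walk_axis_unit hy c (fun t => Qc (c t)) (fun t => Ac (c t)) (fun t => fc (c t)) u
    (K := t) (by omega) hA1 hf1 hinj1 hex1 hBll t le_rfl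
  have hwin := (sheet_walk_record hy c (fun t => Qc (c t)) (fun t => Ac (c t)) (fun t => fc (c t)) u
    (K := t) (by omega) hA1 hf1 hinj1 hex1 hBll t le_rfl).1
  have hht := sheet_walk_height hy c (fun t => Qc (c t)) (fun t => Ac (c t)) (fun t => fc (c t)) u
    (K := t) (by omega) hA1 hf1 hinj1 hex1 hBll t le_rfl
  rw [← hn] at hax hht
  refine ⟨⟨σ, hσ, hax.trans (by nlinarith [ht'])⟩, hwin, ?_, hht.trans (mul_le_mul_of_nonneg_right (by nlinarith [ht', ht0]) hν₀.le)⟩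
  have h2 := (abs_le.1 hwin).2
  nlinarith [h2, hν₀.le, ht']

include hP

/-- Along an h-chain `c 0 … c t` of the ball (`t ≤ 59`) with a target `T` (height `≤ η ν_0` over the plane `(y (c 0), n)`, REGION
`dist T (y j) + (E + 1.03) ν_0 ≤ ρ₁ ν_j`, `τ² + (η + 0.61)² ≤ E²`) at lateral distance `≤ τ ν_0` from `y (c t)`: a basal step `u₁ ↦ y m'` at `c t`
obeying the greedy step's law (ii) and length bound (iii) ADVANCES the hop — the normalised law `R'² ≤ R² − 1.68 R + 1.0435`
(`…SheetCover.descent_law_normalise`), the new site is in the ball (`‖T − y (c t)‖ ≤ E ν_0` by `…SheetCross.dist_sq_le_of_height_of_lateral`,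
`+ 1.03 ν_0` for the step), and it is an h-site (`…SheetLetter.basal_step_record` (A)). [this file · kind: proof] -/
theorem sheet_hop_advance {c : ℕ → Fin N} {u : ℕ → E3} {t : ℕ} (ht : t ≤ 59)
    (hAll : ∀ t', t' ≤ t → dist (y (c t')) (y j) ≤ ρ₁ * nearestDist y j ∧ Pc (c t') = hcpTwoShellPattern)
    (hBll : ∀ t', t' < t → u t' ∈ hcpTwoShellPattern ∧ u t' 0 + u t' 1 + u t' 2 = 0 ∧ fc (c t') (u t') = y (c (t' + 1)))
    {n : E3} (hn : n = (‖Ac (c 0) ((Real.sqrt 18)⁻¹ • intVec ![4, 4, 4])‖⁻¹ • Ac (c 0) ((Real.sqrt 18)⁻¹ • intVec ![4, 4, 4]) : E3))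
    (T : E3) {η E τ : ℝ} (hη : |⟪n, T - y (c 0)⟫_ℝ| ≤ η * nearestDist y (c 0)) (hE0 : 0 ≤ E)
    (hE : τ ^ 2 + (η + 61 / 100) ^ 2 ≤ E ^ 2)
    (hregion : dist T (y j) + (E + 103 / 100) * nearestDist y (c 0) ≤ ρ₁ * nearestDist y j)
    (hlat : ‖(T - y (c t)) - ⟪n, T - y (c t)⟫_ℝ • n‖ ≤ τ * nearestDist y (c 0))
    {u₁ : E3} {m' : Fin N} (hu : u₁ ∈ hcpTwoShellPattern) (hu0 : u₁ 0 + u₁ 1 + u₁ 2 = 0) (hmu : fc (c t) u₁ = y m')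
    (hii : ‖((T - y (c t)) - (y m' - y (c t))) - ⟪n, (T - y (c t)) - (y m' - y (c t))⟫_ℝ • n‖ ^ 2 ≤
      ‖(T - y (c t)) - ⟪n, T - y (c t)⟫_ℝ • n‖ ^ 2 - 43 / 25 * nearestDist y (c t) * ‖(T - y (c t)) - ⟪n, T - y (c t)⟫_ℝ • n‖
        + 10023 / 10000 * nearestDist y (c t) ^ 2)
    (hiii : ‖y m' - y (c t)‖ ≤ 10011 / 10000 * nearestDist y (c t)) :
    (‖(T - y m') - ⟪n, T - y m'⟫_ℝ • n‖ / nearestDist y (c 0)) ^ 2 ≤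
      (‖(T - y (c t)) - ⟪n, T - y (c t)⟫_ℝ • n‖ / nearestDist y (c 0)) ^ 2
        - 42 / 25 * (‖(T - y (c t)) - ⟪n, T - y (c t)⟫_ℝ • n‖ / nearestDist y (c 0)) + 10435 / 10000 ∧
    dist (y m') (y j) ≤ ρ₁ * nearestDist y j ∧ Pc m' = hcpTwoShellPattern := by
  obtain ⟨hA1, hf1, hinj1, hex1⟩ := chain_charts hA hf hinj hex hAll
  have hν₀ : 0 < nearestDist y (c 0) :=
    nearestDist_pos_of_frame hy (Or.inr rfl) (fun v hv => (hf1 0 (Nat.zero_le _) v hv).1) (hinj1 0 (Nat.zero_le _))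
  obtain ⟨-, hwin, hνt, hheight⟩ := sheet_hop_guard hy hA hf hinj hex ht hAll hBll hn
  obtain ⟨hball, hPm⟩ := hAll t le_rfl
  obtain ⟨hAm, hfm, hinjm, hexm⟩ := site_charts hA hf hinj hex hball hPm
  have hn1 : ‖n‖ = 1 := by
    obtain ⟨hL', -⟩ := frame_axis_norm (frame_axis_close (hA1 0 (Nat.zero_le _)))
    have hne : ‖Ac (c 0) ((Real.sqrt 18)⁻¹ • intVec ![4, 4, 4])‖ ≠ 0 := by intro h; rw [h] at hL'; norm_num at hL'
    rw [hn, norm_smul, norm_inv, norm_norm, inv_mul_cancel₀ hne]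
  -- the law
  have e1 : T - y (c t) - (y m' - y (c t)) = T - y m' := by abel
  rw [e1] at hii
  -- the new site is in the ball …
  have hdistT : dist T (y (c t)) ≤ E * nearestDist y (c 0) := by
    have h := dist_sq_le_of_height_of_lateral hn1 hη hheight hlat
    have h3 : (η * nearestDist y (c 0) + 61 / 100 * nearestDist y (c 0)) ^ 2 + (τ * nearestDist y (c 0)) ^ 2 =
        (τ ^ 2 + (η + 61 / 100) ^ 2) * nearestDist y (c 0) ^ 2 := by ring
    rw [h3] at h
    have h2 : ‖T - y (c t)‖ ^ 2 ≤ (E * nearestDist y (c 0)) ^ 2 :=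
      h.trans (by rw [mul_pow]; exact mul_le_mul_of_nonneg_right hE (sq_nonneg _))
    rw [dist_eq_norm]
    exact (pow_le_pow_iff_left₀ (norm_nonneg _) (mul_nonneg hE0 hν₀.le) two_ne_zero).1 h2
  have h1 : dist (y m') (y (c t)) ≤ 103 / 100 * nearestDist y (c 0) := by
    rw [dist_eq_norm]; exact hiii.trans (by nlinarith [hνt, hν₀.le])
  have hball' : dist (y m') (y j) ≤ ρ₁ * nearestDist y j :=
    calc dist (y m') (y j) ≤ dist (y m') (y (c t)) + dist (y (c t)) T + dist T (y j) := dist_triangle4 _ _ _ _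
      _ ≤ 103 / 100 * nearestDist y (c 0) + E * nearestDist y (c 0) + dist T (y j) := by
          rw [dist_comm (y (c t)) T]; linarith
      _ ≤ ρ₁ * nearestDist y j := by linarith [hregion]
  -- … and an h-site
  exact ⟨descent_law_normalise hν₀ (norm_nonneg _) ht hwin hii, hball',
    (basal_step_record hy hAm hfm hinjm hexm (hP _ hball') (hA _ hball') (hf _ hball') (hinj _ hball') (hex _ hball')
      hu hu0 hmu).1⟩

/-- ★★ **ONE HOP OF THE COVERING WALK.**  Chart datum on `B(y j, ρ₁ ν_j)`; an h-chain `c 0 … c L` in the ball with basal steps `w t` (`fc (c t) (w t) =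
y (c (t+1))`); a MODE `(k, τ) ∈ {(7, 131/25), (4, 287/100), (3, 53/25)}` (the three rungs of `…SheetCover.descent_envelope`) with `L + k ≤ 60`; `n` the
unit axis of the first chart; a target `T` at height `≤ η ν_0` over the plane `(y (c 0), n)` and at lateral distance `≤ τ ν_0` from `y (c L)`; numbers
`E ≥ 0` with `τ² + (η + 0.61)² ≤ E²` and the REGION inequality `dist T (y j) + (E + 1.03) ν_0 ≤ ρ₁ ν_j`.  Then the chain extends (same sites up to `L`,
same steps below `L`) by `s ≤ k` basal steps, all new sites in the ball and h-sites, to a site at lateral distance `≤ (16/25) ν_0` from `T`.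
(`ν_0 = ν_{c 0}`; by `…SheetCover.stop_radius_le` this is `≤ (3/4) ν` in the stopping site's own scale.) [this file · kind: proof] -/
theorem sheet_hop {c : ℕ → Fin N} {w : ℕ → E3} {L k : ℕ} {τ : ℝ}
    (hk : (k = 7 ∧ τ = 131 / 25) ∨ (k = 4 ∧ τ = 287 / 100) ∨ (k = 3 ∧ τ = 53 / 25)) (hL : L + k ≤ 60)
    (hpre : ∀ t, t ≤ L → dist (y (c t)) (y j) ≤ ρ₁ * nearestDist y j ∧ Pc (c t) = hcpTwoShellPattern)
    (hstep : ∀ t, t < L → w t ∈ hcpTwoShellPattern ∧ w t 0 + w t 1 + w t 2 = 0 ∧ fc (c t) (w t) = y (c (t + 1)))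
    {n : E3} (hn : n = (‖Ac (c 0) ((Real.sqrt 18)⁻¹ • intVec ![4, 4, 4])‖⁻¹ • Ac (c 0) ((Real.sqrt 18)⁻¹ • intVec ![4, 4, 4]) : E3))
    (T : E3) {η E : ℝ} (hη : |⟪n, T - y (c 0)⟫_ℝ| ≤ η * nearestDist y (c 0)) (hE0 : 0 ≤ E)
    (hE : τ ^ 2 + (η + 61 / 100) ^ 2 ≤ E ^ 2)
    (hregion : dist T (y j) + (E + 103 / 100) * nearestDist y (c 0) ≤ ρ₁ * nearestDist y j)
    (hR0 : ‖(T - y (c L)) - ⟪n, T - y (c L)⟫_ℝ • n‖ ≤ τ * nearestDist y (c 0)) :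
    ∃ (c' : ℕ → Fin N) (w' : ℕ → E3) (s : ℕ), s ≤ k ∧ (∀ t, t ≤ L → c' t = c t) ∧ (∀ t, t < L → w' t = w t) ∧
      (∀ t, t ≤ L + s → dist (y (c' t)) (y j) ≤ ρ₁ * nearestDist y j ∧ Pc (c' t) = hcpTwoShellPattern) ∧
      (∀ t, t < L + s → w' t ∈ hcpTwoShellPattern ∧ w' t 0 + w' t 1 + w' t 2 = 0 ∧ fc (c' t) (w' t) = y (c' (t + 1))) ∧
      ‖(T - y (c' (L + s))) - ⟪n, T - y (c' (L + s))⟫_ℝ • n‖ ≤ 16 / 25 * nearestDist y (c 0) := by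
  classical
  have hk7 : k ≤ 7 := by rcases hk with ⟨rfl, -⟩ | ⟨rfl, -⟩ | ⟨rfl, -⟩ <;> norm_num
  set a : E3 := (Real.sqrt 18)⁻¹ • intVec ![4, 4, 4] with hadef
  set ν₀ := nearestDist y (c 0) with hν₀def
  -- the first chart: positivity of `ν₀`, `‖n‖ = 1`
  obtain ⟨hA0, hf0, hinj0, -⟩ := chain_charts hA hf hinj hex hpre
  have hν₀ : 0 < ν₀ := nearestDist_pos_of_frame hy (Or.inr rfl) (fun v hv => (hf0 0 (Nat.zero_le _) v hv).1) (hinj0 0 (Nat.zero_le _))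
  have hn1 : ‖n‖ = 1 := by
    obtain ⟨hL', -⟩ := frame_axis_norm (frame_axis_close (hA0 0 (Nat.zero_le _)))
    have hne : ‖Ac (c 0) a‖ ≠ 0 := by intro h; rw [h] at hL'; norm_num at hL'
    rw [hn, norm_smul, norm_inv, norm_norm, inv_mul_cancel₀ hne]
  -- the greedy choice at every site (guarded), and the successor site
  have key : ∀ m : Fin N, ∃ u : E3,
      (dist (y m) (y j) ≤ ρ₁ * nearestDist y j ∧ Pc m = hcpTwoShellPattern ∧
        ∃ σ : ℝ, (σ = 1 ∨ σ = -1) ∧ ‖(‖Ac m a‖⁻¹ • Ac m a : E3) - σ • n‖ ≤ 1 / 50) →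
      u ∈ hcpTwoShellPattern ∧ u 0 + u 1 + u 2 = 0 ∧ ∀ m' : Fin N, fc m u = y m' →
        43 / 50 * nearestDist y m * ‖(T - y m) - ⟪n, T - y m⟫_ℝ • n‖ ≤ ⟪(T - y m) - ⟪n, T - y m⟫_ℝ • n, y m' - y m⟫_ℝ ∧
        ‖((T - y m) - (y m' - y m)) - ⟪n, (T - y m) - (y m' - y m)⟫_ℝ • n‖ ^ 2 ≤
          ‖(T - y m) - ⟪n, T - y m⟫_ℝ • n‖ ^ 2 - 43 / 25 * nearestDist y m * ‖(T - y m) - ⟪n, T - y m⟫_ℝ • n‖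
            + 10023 / 10000 * nearestDist y m ^ 2 ∧
        ‖y m' - y m‖ ≤ 10011 / 10000 * nearestDist y m := by
    intro m
    by_cases H : dist (y m) (y j) ≤ ρ₁ * nearestDist y j ∧ Pc m = hcpTwoShellPattern ∧
        ∃ σ : ℝ, (σ = 1 ∨ σ = -1) ∧ ‖(‖Ac m a‖⁻¹ • Ac m a : E3) - σ • n‖ ≤ 1 / 50
    · obtain ⟨hball, hPm, σ, hσ, hNn⟩ := H
      obtain ⟨hAm, hfm, hinjm, -⟩ := site_charts hA hf hinj hex hball hPm
      obtain ⟨u, hu, hu0, hgood⟩ := greedy_step hy hAm hfm hinjm hn1 hσ hNn (T - y m)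
      exact ⟨u, fun _ => ⟨hu, hu0, hgood⟩⟩
    · exact ⟨0, fun h => absurd h H⟩
  choose U hU using key
  have key2 : ∀ m : Fin N, ∃ m' : Fin N, fc m (U m) ∈ Set.range y → y m' = fc m (U m) := by
    intro m
    by_cases H : fc m (U m) ∈ Set.range y
    · obtain ⟨m', hm'⟩ := H
      exact ⟨m', fun _ => hm'⟩
    · exact ⟨m, fun h => absurd h H⟩
  choose nxt hnxt using key2
  -- the extended chain and its steps
  obtain ⟨d, hd⟩ : ∃ d : ℕ → Fin N, d = fun s => nxt^[s] (c L) := ⟨_, rfl⟩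
  obtain ⟨c', hc'⟩ : ∃ c' : ℕ → Fin N, c' = fun t => if t ≤ L then c t else d (t - L) := ⟨_, rfl⟩
  obtain ⟨w', hw'⟩ : ∃ w' : ℕ → E3, w' = fun t => if t < L then w t else U (c' t) := ⟨_, rfl⟩
  have hc'le : ∀ t, t ≤ L → c' t = c t := fun t ht => by simp only [hc', if_pos ht]
  have hc'd : ∀ s, c' (L + s) = d s := by
    intro s
    rcases Nat.eq_zero_or_pos s with hs | hs
    · subst hs; simp [hc', hd]
    · simp only [hc', if_neg (by omega : ¬ (L + s ≤ L)), Nat.add_sub_cancel_left]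
  have hsucc : ∀ s, c' (L + s + 1) = nxt (c' (L + s)) := by
    intro s
    rw [hc'd s, show L + s + 1 = L + (s + 1) by omega, hc'd (s + 1), hd]
    exact Function.iterate_succ_apply' nxt s (c L)
  have hw'ge : ∀ s, w' (L + s) = U (c' (L + s)) := fun s => by simp only [hw', if_neg (by omega : ¬ (L + s < L))]
  have hw'lt : ∀ t, t < L → w' t = w t := fun t ht => by simp only [hw', if_pos ht]
  have hc'0 : c' 0 = c 0 := hc'le 0 (Nat.zero_le _)
  have hn' : n = (‖Ac (c' 0) a‖⁻¹ • Ac (c' 0) a : E3) := by rw [hc'0]; exact hn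
  -- the lateral distance to the target, in units of `ν₀`
  obtain ⟨R, hR⟩ : ∃ R : ℕ → ℝ, R = fun t => ‖(T - y (c' t)) - ⟪n, T - y (c' t)⟫_ℝ • n‖ / ν₀ := ⟨_, rfl⟩
  have hRt : ∀ t, R t * ν₀ = ‖(T - y (c' t)) - ⟪n, T - y (c' t)⟫_ℝ • n‖ := fun t => by rw [hR]; field_simp
  have hRnn : ∀ t, 0 ≤ R t := fun t => by rw [hR]; exact div_nonneg (norm_nonneg _) hν₀.le
  have hRL : R L ≤ τ := by
    have h1 : R L * ν₀ ≤ τ * ν₀ := by rw [hRt, hc'le L le_rfl]; exact hR0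
    exact le_of_mul_le_mul_right h1 hν₀
  -- ### the induction WHILE THE HOP RUNS
  have claim : ∀ s, s ≤ k → (∀ s', s' < s → 16 / 25 < R (L + s')) →
      (∀ t, t ≤ L + s → dist (y (c' t)) (y j) ≤ ρ₁ * nearestDist y j ∧ Pc (c' t) = hcpTwoShellPattern) ∧
      (∀ t, t < L + s → w' t ∈ hcpTwoShellPattern ∧ w' t 0 + w' t 1 + w' t 2 = 0 ∧ fc (c' t) (w' t) = y (c' (t + 1))) ∧
      R (L + s) ≤ τ ∧
      (∀ s', s' < s → R (L + s' + 1) ^ 2 ≤ R (L + s') ^ 2 - 42 / 25 * R (L + s') + 10435 / 10000) := by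
    intro s
    induction s with
    | zero =>
      intro _ _
      refine ⟨fun t ht => ?_, fun t ht => ?_, by simpa using hRL, fun s' hs' => absurd hs' (Nat.not_lt_zero _)⟩
      · rw [Nat.add_zero] at ht
        rw [hc'le t ht]; exact hpre t ht
      · rw [Nat.add_zero] at ht
        rw [hw'lt t ht, hc'le t ht.le, hc'le (t + 1) ht]; exact hstep t ht
    | succ s ih =>
      intro hsk hrun
      obtain ⟨hAll, hBll, hC, hD⟩ := ih (by omega) (fun s' hs' => hrun s' (by omega))
      have ht59 : L + s ≤ 59 := by omega
      obtain ⟨hball, hPm⟩ := hAll (L + s) le_rfl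
      -- the greedy step fires
      obtain ⟨hguard, -, -, -⟩ := sheet_hop_guard hy hA hf hinj hex ht59 hAll hBll hn'
      obtain ⟨hu, hu0, hgood⟩ := hU (c' (L + s)) ⟨hball, hPm, hguard⟩
      have hrange : fc (c' (L + s)) (U (c' (L + s))) ∈ Set.range y :=
        ((site_charts hA hf hinj hex hball hPm).2.1 _ hu).1
      have hy' : fc (c' (L + s)) (U (c' (L + s))) = y (c' (L + s + 1)) := by rw [hsucc s]; exact (hnxt _ hrange).symm
      obtain ⟨-, hii, hiii⟩ := hgood (c' (L + s + 1)) hy'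
      -- the hop advances
      have hη' : |⟪n, T - y (c' 0)⟫_ℝ| ≤ η * nearestDist y (c' 0) := by rw [hc'0]; exact hη
      have hregion' : dist T (y j) + (E + 103 / 100) * nearestDist y (c' 0) ≤ ρ₁ * nearestDist y j := by rw [hc'0]; exact hregion
      have hlat : ‖(T - y (c' (L + s))) - ⟪n, T - y (c' (L + s))⟫_ℝ • n‖ ≤ τ * nearestDist y (c' 0) := by
        rw [hc'0, ← hν₀def, ← hRt]; exact mul_le_mul_of_nonneg_right hC hν₀.le
      obtain ⟨hlaw0, hball', hP'⟩ := sheet_hop_advance hy hP hA hf hinj hex ht59 hAll hBll hn' T hη' hE0 hE hregion' hlat hu hu0 hy' hii hiii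
      rw [hc'0, ← hν₀def] at hlaw0
      have hlaw : R (L + s + 1) ^ 2 ≤ R (L + s) ^ 2 - 42 / 25 * R (L + s) + 10435 / 10000 := by
        have e : ∀ t, ‖(T - y (c' t)) - ⟪n, T - y (c' t)⟫_ℝ • n‖ / ν₀ = R t := fun t => by rw [hR]
        rw [e, e] at hlaw0
        exact hlaw0
      have hgt : 16 / 25 < R (L + s) := hrun s (by omega)
      have hRmono : R (L + s + 1) ≤ R (L + s) := by
        have h2 : R (L + s + 1) ^ 2 ≤ R (L + s) ^ 2 := by nlinarith [hlaw, hgt]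
        exact (pow_le_pow_iff_left₀ (hRnn _) (hRnn _) two_ne_zero).1 h2
      refine ⟨fun t ht => ?_, fun t ht => ?_, ?_, fun s' hs' => ?_⟩
      · rcases Nat.lt_or_eq_of_le ht with h | h
        · exact hAll t (by omega)
        · rw [h, show L + (s + 1) = L + s + 1 by omega]; exact ⟨hball', hP'⟩
      · by_cases h : t < L + s
        · exact hBll t h
        · have hts : t = L + s := by omega
          rw [hts, hw'ge s]
          exact ⟨hu, hu0, hy'⟩
      · rw [show L + (s + 1) = L + s + 1 by omega]; exact hRmono.trans hC
      · rcases Nat.lt_or_eq_of_le (Nat.lt_succ_iff.1 hs') with h | h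
        · exact hD s' h
        · rw [h]; exact hlaw
  -- ### the hop stops within `k` steps (the rung of `descent_envelope` named by the mode); take the first stop
  have hlawk : ∀ s, s < k → (∀ s', s' ≤ s → 16 / 25 < R (L + s')) →
      R (L + s + 1) ^ 2 ≤ R (L + s) ^ 2 - 42 / 25 * R (L + s) + 10435 / 10000 := fun s hs hrun =>
    (claim (s + 1) (by omega) (fun s' hs' => hrun s' (Nat.lt_succ_iff.1 hs'))).2.2.2 s (lt_add_one s)
  have hexs : ∃ s, s ≤ k ∧ R (L + s) ≤ 16 / 25 := by
    rcases hk with ⟨rfl, rfl⟩ | ⟨rfl, rfl⟩ | ⟨rfl, rfl⟩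
    · exact (descent_envelope R L 7 hRnn hlawk).1 le_rfl hRL
    · exact (descent_envelope R L 4 hRnn hlawk).2.1 le_rfl hRL
    · exact (descent_envelope R L 3 hRnn hlawk).2.2 le_rfl hRL
  obtain ⟨hs₀7, hs₀stop⟩ := Nat.find_spec hexs
  have hrun₀ : ∀ s', s' < Nat.find hexs → 16 / 25 < R (L + s') := by
    intro s' hs'
    have h := Nat.find_min hexs hs'
    by_contra hle
    exact h ⟨by omega, not_lt.1 hle⟩
  obtain ⟨hAll, hBll, -, -⟩ := claim (Nat.find hexs) hs₀7 hrun₀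
  refine ⟨c', w', Nat.find hexs, hs₀7, hc'le, hw'lt, hAll, hBll, ?_⟩
  rw [← hRt]
  exact mul_le_mul_of_nonneg_right hs₀stop hν₀.le

end Atlas

end Summit.AtomisticToContinuum.Crystallization.Theorems.OverbindingBudgetAffineRunCutSheetHop
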